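import Summits.QuantumFields.QCD.Theses.HeatSlicedQuarks

/-!
# Line `heavy-goldstone-continuation` — skeleton (strategist cstrat-stmt-QuantumFields-8892-s1, gen 1, 2026-08-17)

Crux `stmt-QuantumFields-8892`,
`Summit.QuantumFields.QCD.Theses.HeatSlicedQuarks.RobustYangMillsHandover := ContinuumQCDExists → QCD`
(re-typed conjunct: `QCDOf N_f` conjoins `reg.IsChiralAtZero`, p117723).

## What this line is

The TYPED R1 DECOMPOSITION that leads c2–c13 and both round-2 triagers asked for, registered as a line because
`route edit --split` is refused to a non-final seat (gate, 2026-08-17T02:3xZ; `children.json` + this glue are attached to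
the crux for the first seat with split rights).  Three stubs, each a proposed ITEM (crux-sized by design — the point of
R1 is that the parent's difficulty is two different open problems plus one stability theorem, to be staffed separately):

* `stub_heavyThresholdHandover` — `ContinuumQCDExists → ThresholdQCD` (consequent = the body of
  `HeavyThresholdYMBridge.ThresholdQCD` verbatim): the PRE-RE-TYPE crux.  Every round-1 line of this crux
  (`existence-pays-the-continuum-half`, `geometric-mean-handover`, `threshold-irrelevance-squeeze`,
  `low-mode-quarantine`, `two-scale-lsi-handover`; C⁺ = heavy-threshold gaps for X₀'s regularisation, dead ONLY at the
  re-typed head) is a line for this stub verbatim; 8922 + a correctly quantified transfer prove it.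
* `stub_gaplessPointOnMassAxis` — for every threshold-QCD regularisation some offset `M` has NO uniform lattice rate
  above it (`∀ ε > 0` a tuple above `M` is not `ε`-gapped): a gapless point on the Wilson mass axis (Goldstone /
  anomaly matching).  The NO-gap input; `∃ M, (m_crit-shift by M).IsChiralAtZero` unfolded.
* `stub_gappedMassContinuation` — UNIFORM openness of gapped massive QCD in the mass offset: `∀ ε ∃ δ ∀ M`, a uniform
  rate `ε` above `M` plus the full `QCDOf` body above `M` continue the body to `M − δ`.  The STABILITY input; `δ`
  independent of `M` (TRIAGE-r2-2 sharpen (b): content wherever the rate `ε` is attained, not only at the pin).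

## Why it dodges the STUCK goals of the registered lines

* Round 1 died at `⊢ (shiftReg reg M₀).IsChiralAtZero` (StuckGoalC4): here chirality at the pin is DERIVED
  (`exists_pin_of_threshold_gapless_continuation`: the bottom of the body's up-set cannot carry a uniform rate, else
  continuation moves it) from a no-gap input placed ANYWHERE on the axis and a stability input stated for EVERY offset.
* Round 2 (`lee_yang_mass_handover` gen 5.1, `SketchR2K4PinTheInfimum`) died at `stub_pinnedData` (honest data BELOW
  X₀'s offset, target-sized, no mechanism) and `stub_wardTripleAtPin` / `OpensBelow` (conclusion-equivalent at the
  pin): here data below any anchor are produced by CONTINUATION from a uniformly gapped, existing theory (a mechanism: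
  sigma-term Lipschitz bound + analyticity/Vitali in the mass), and X₀'s regularisation is left as soon as child 1 has
  consumed it (the pin lives on the threshold-QCD regularisation child 1 outputs, whichever it is).
* Disproof.lean (cdisprove cycles 1–3; `-- Targets: none`; no `_false_without_` theorem exists): §2 non-triviality is
  used inside child 1 (its consequent carries the three clauses) and child 2 (honesty of the hypothesis is what ties
  `m_crit` to the critical line); §5/§8 threshold forms are exactly child 1's consequent; §9/§12 (hopping window,
  `η(j*)`) constrain child 1's lines as before; §13 (G4) is flagged in child 3's why-it-might-fail; landed
  `Negative/ChiralityObstruction.not_isChiralAtZero_mcrit_shift_of_uniformGapAbove` is precisely why the pin must sit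
  OUTSIDE `U` — the glue never shifts inside a uniformly gapped half-line.

## Composition

`RobustYangMillsHandover_of_subs : child 1 → child 2 → child 3 → RobustYangMillsHandover` (sorry-free, explicit
hypotheses — the `--glue-by` theorem of the split) and `RobustYangMillsHandover_of : RobustYangMillsHandover` from the
three `stub_*` (sorries ONLY there).  Imports the route module only.
-/

namespace Summit.QuantumFields.QCD.Cruxes.RobustYangMillsHandover.HeavyGoldstoneContinuation

open Summit.QuantumFields.QCD.Theses.HeatSlicedQuarks
open Literature.MathematicalPhysics.QuantumFieldTheory

/-! ## §1 The three registered stubs (= the proposed children of the split, stated literally) -/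

/-- **stub_heavyThresholdHandover — child 1, HEAVY-THRESHOLD HANDOVER** (`X₀ → ThresholdQCD`; the pre-re-type crux):
for `N_f = 2, 3` some mass-scaling regularisation and some offset `M₀ ≥ 0` above which every tuple carries honest
continuum data with the three non-triviality clauses AND one gap of `T` and of the lattice theory.  Contains robust
SU(3) Yang–Mills + heavy-quark decoupling (open); size: crux. -/
theorem stub_heavyThresholdHandover :
    ContinuumQCDExists → ∀ Nf : ℕ, Nf = 2 ∨ Nf = 3 → ∃ M₀ : ℝ, 0 ≤ M₀ ∧ ∃ reg : Literature.MathematicalPhysics.QuantumFieldTheory.QCDRegularisation Nf, reg.HasMassScaling ∧ ∀ m : Fin Nf → ℝ, (∀ f, M₀ < m f) → ∃ (z shift : Literature.MathematicalPhysics.QuantumFieldTheory.QCDField Nf → ℕ → ℝ) (T : Literature.MathematicalPhysics.QuantumFieldTheory.OSData (Literature.MathematicalPhysics.QuantumFieldTheory.QCDField Nf) 4), Literature.MathematicalPhysics.QuantumFieldTheory.IsQCDAlong (reg.scheme m z shift) T ∧ T.IsNontrivial Literature.MathematicalPhysics.QuantumFieldTheory.QCDField.glue ∧ T.IsNonGaussian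 Literature.MathematicalPhysics.QuantumFieldTheory.QCDField.glue ∧ (∀ f g : Fin Nf, f ≠ g → T.IsNontrivial (Literature.MathematicalPhysics.QuantumFieldTheory.QCDField.pseudoRe f g)) ∧ ∃ Δ > 0, T.HasMassGap Δ ∧ (reg.scheme m z shift).HasLatticeMassGap Δ := by
  sorry

/-- **stub_gaplessPointOnMassAxis — child 2, A GAPLESS POINT ON THE MASS AXIS** (Goldstone / anomaly-matching input):
every threshold-QCD regularisation has an offset above which the lattice rate is not uniform.  Size: crux (no
weak-coupling lattice proof of Goldstone gaplessness exists). -/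
theorem stub_gaplessPointOnMassAxis :
    ∀ Nf : ℕ, Nf = 2 ∨ Nf = 3 → ∀ reg : Literature.MathematicalPhysics.QuantumFieldTheory.QCDRegularisation Nf, reg.HasMassScaling → (∃ M₀ : ℝ, ∀ m : Fin Nf → ℝ, (∀ f, M₀ < m f) → ∃ (z shift : Literature.MathematicalPhysics.QuantumFieldTheory.QCDField Nf → ℕ → ℝ) (T : Literature.MathematicalPhysics.QuantumFieldTheory.OSData (Literature.MathematicalPhysics.QuantumFieldTheory.QCDField Nf) 4), Literature.MathematicalPhysics.QuantumFieldTheory.IsQCDAlong (reg.scheme m z shift) T ∧ T.IsNontrivial Literature.MathematicalPhysics.QuantumFieldTheory.QCDField.glue ∧ T.IsNonGaussian Literature.MathematicalPhysics.QuantumFieldTheory.QCDField.glue ∧ (∀ f g : Fin Nf, f ≠ g → T.IsNontrivial (Literature.MathematicalPhysics.QuantumFieldTheory.QCDField.pseudoRe f g)) ∧ ∃ Δ > 0, T.HasMassGap Δ ∧ (reg.scheme m z shift).HasLatticeMassGap Δ) → ∃ M : ℝ, ∀ ε : ℝ, 0 < ε → ∃ m : Fin Nf → ℝ, (∀ f,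 M < m f) ∧ ¬ (reg.scheme m 0 0).HasLatticeMassGap ε := by
  sorry

/-- **stub_gappedMassContinuation — child 3, UNIFORM GAPPED-MASS CONTINUATION** (stability input): for every rate
`ε > 0` a continuation length `δ(reg, ε) > 0`, uniform in the anchor `M`.  Size: crux (k-uniform stability of a gapped
lattice gauge theory under the relevant perturbation `−δ·ψ̄ψ`; hardest stub). -/
theorem stub_gappedMassContinuation :
    ∀ Nf : ℕ, Nf = 2 ∨ Nf = 3 → ∀ reg : Literature.MathematicalPhysics.QuantumFieldTheory.QCDRegularisation Nf, reg.HasMassScaling → ∀ ε : ℝ, 0 < ε → ∃ δ : ℝ, 0 < δ ∧ ∀ M : ℝ, (∀ m : Fin Nf → ℝ, (∀ f, M < m f) → (reg.scheme m 0 0).HasLatticeMassGap ε) → (∀ m : Fin Nf → ℝ, (∀ f, M < m f) → ∃ (z shift : Literature.MathematicalPhysics.QuantumFieldTheory.QCDField Nf → ℕ → ℝ) (T : Literature.MathematicalPhysics.QuantumFieldTheory.OSData (Literature.MathematicalPhysics.QuantumFieldTheory.QCDField Nf) 4), Literature.MathematicalPhysics.QuantumFieldTheory.IsQCDAlong (reg.scheme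 m z shift) T ∧ T.IsNontrivial Literature.MathematicalPhysics.QuantumFieldTheory.QCDField.glue ∧ T.IsNonGaussian Literature.MathematicalPhysics.QuantumFieldTheory.QCDField.glue ∧ (∀ f g : Fin Nf, f ≠ g → T.IsNontrivial (Literature.MathematicalPhysics.QuantumFieldTheory.QCDField.pseudoRe f g)) ∧ ∃ Δ > 0, T.HasMassGap Δ ∧ (reg.scheme m z shift).HasLatticeMassGap Δ) → ∀ m : Fin Nf → ℝ, (∀ f, M - δ < m f) → ∃ (z shift : Literature.MathematicalPhysics.QuantumFieldTheory.QCDField Nf → ℕ → ℝ) (T : Literature.MathematicalPhysics.QuantumFieldTheory.OSData (Literature.MathematicalPhysics.QuantumFieldTheory.QCDField Nf) 4), Literature.MathematicalPhysics.QuantumFieldTheory.IsQCDAlong (reg.scheme m z shift) T ∧ T.IsNontrivial Literature.MathematicalPhysics.QuantumFieldTheory.QCDField.glue ∧ T.IsNonGaussian Literature.MathematicalPhysics.QuantumFieldTheory.QCDField.glue ∧ (∀ f g : Fin Nf, f ≠ g → T.IsNontrivial (Literature.MathematicalPhysics.QuantumFieldTheory.QCDField.pseudoRe f g)) ∧ ∃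 Δ > 0, T.HasMassGap Δ ∧ (reg.scheme m z shift).HasLatticeMassGap Δ := by
  sorry

/-! ## §2 The glue (sorry-free): `m_crit`-shift pin, order-theoretic core, and the split theorem -/

variable {Nf : ℕ}

/-! ## §0 The `m_crit`-shift and the pin lemma (body form) -/

/-- The `m_crit`-shift of a regularisation by the offset `P` (realised masses `m` ↦ offsets `P + m`). [folklore] -/
noncomputable def shiftReg (reg : QCDRegularisation Nf) (P : ℝ) : QCDRegularisation Nf :=
  { reg with mcrit := fun k => reg.mcrit k + reg.a k * P / reg.Zm k }

/-- The shifted scheme at `m` IS the original scheme at `P + m`. [folklore] -/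
theorem shiftReg_scheme (reg : QCDRegularisation Nf) (P : ℝ) (m : Fin Nf → ℝ)
    (z shift : QCDField Nf → ℕ → ℝ) :
    (shiftReg reg P).scheme m z shift = reg.scheme (fun f => P + m f) z shift := by
  simp only [shiftReg, QCDRegularisation.scheme, QCDScheme.mk.injEq, true_and, and_true]
  funext f k
  ring

/-- The shift keeps `HasMassScaling` (which never reads `m_crit`). [folklore] -/
theorem shiftReg_hasMassScaling_iff (reg : QCDRegularisation Nf) (P : ℝ) :
    (shiftReg reg P).HasMassScaling ↔ reg.HasMassScaling :=
  Iff.rfl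

/-- **`QCDOf` at a pin, body form**: a mass-scaling regularisation, an offset `P` with no uniform lattice rate just
above it, and the full body at every tuple above `P` give `QCDOf N_f` — witnessed by the `m_crit`-shift by `P`, whose
chirality clause is literally "no uniform rate just above `P`". [folklore] -/
theorem qcdOf_of_pin_body (reg : QCDRegularisation Nf) (hMS : reg.HasMassScaling) (P : ℝ)
    (hχ : ∀ ε > (0 : ℝ), ∃ t : Fin Nf → ℝ, (∀ f, P < t f) ∧ ¬ (reg.scheme t 0 0).HasLatticeMassGap ε)
    (hG : ∀ t : Fin Nf → ℝ, (∀ f, P < t f) → (∃ (z shift : QCDField Nf → ℕ → ℝ) (T : OSData (QCDField Nf) 4), IsQCDAlong (reg.scheme t z shift) T ∧ T.IsNontrivial QCDField.glue ∧ T.IsNonGaussian QCDField.glue ∧ (∀ f g : Fin Nf, f ≠ g → T.IsNontrivial (QCDField.pseudoRe f g)) ∧ ∃ Δ > 0, T.HasMassGap Δ ∧ (reg.scheme t z shift).HasLatticeMassGap Δ)) : QCDOf Nf := by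
  refine ⟨shiftReg reg P, (shiftReg_hasMassScaling_iff reg P).mpr hMS, ?_, ?_⟩
  · -- chirality of the shifted regularisation = no uniform rate just above `P`
    intro ε hε
    obtain ⟨t, ht, hng⟩ := hχ ε hε
    refine ⟨fun f => t f - P, fun f => by linarith [ht f], ?_⟩
    rw [shiftReg_scheme]
    have ht' : (fun f => P + (t f - P)) = t := funext fun f => by ring
    rwa [ht']
  · -- the body at positive masses of the shifted regularisation = the body above `P`
    intro m hm
    obtain ⟨z, shift, T, hA, hN, hGs, hPs, Δ, hΔ, hT, hL⟩ := hG (fun f => P + m f) fun f => by linarith [hm f]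
    refine ⟨z, shift, T, ?_, hN, hGs, hPs, Δ, hΔ, hT, ?_⟩
    · rw [shiftReg_scheme]; exact hA
    · rw [shiftReg_scheme]; exact hL

/-! ## §1 The order-theoretic core -/

/-- A finite tuple strictly above `P` is above `P + δ` for some `δ > 0`. [folklore] -/
theorem exists_pos_add_le_all (P : ℝ) (t : Fin Nf → ℝ) (ht : ∀ f, P < t f) :
    ∃ δ > (0 : ℝ), ∀ f, P + δ ≤ t f := by
  rcases isEmpty_or_nonempty (Fin Nf) with hE | hN
  · exact ⟨1, one_pos, fun f => (hE.false f).elim⟩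
  · obtain ⟨f₀, -, hf₀⟩ := Finset.exists_min_image Finset.univ t Finset.univ_nonempty
    exact ⟨t f₀ - P, by linarith [ht f₀], fun f => by linarith [hf₀ f (Finset.mem_univ f)]⟩

/-- **The order-theoretic core.**  For one regularisation: if the set `G` of offsets above which the body holds is
non-empty (heavy threshold), some offset `M₁` has no uniform rate above it (gapless point), and a uniform rate above
an element `M` of `G` continues the body below `M` (continuation), then some `P ∈ G` has no uniform rate above it.
[folklore] -/
theorem exists_pin_of_threshold_gapless_continuation (reg : QCDRegularisation Nf)
    (hne : ∃ M₀ : ℝ, ∀ t : Fin Nf → ℝ, (∀ f, M₀ < t f) → (∃ (z shift : QCDField Nf → ℕ → ℝ) (T : OSData (QCDField Nf) 4), IsQCDAlong (reg.scheme t z shift) T ∧ T.IsNontrivial QCDField.glue ∧ T.IsNonGaussian QCDField.glue ∧ (∀ f g : Fin Nf, f ≠ g → T.IsNontrivial (QCDField.pseudoRe f g)) ∧ ∃ Δ > 0, T.HasMassGap Δ ∧ (reg.scheme t z shift).HasLatticeMassGap Δ))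
    (hgap : ∃ M₁ : ℝ, ∀ ε > (0 : ℝ), ∃ t : Fin Nf → ℝ, (∀ f, M₁ < t f) ∧ ¬ (reg.scheme t 0 0).HasLatticeMassGap ε)
    (hcont : ∀ M : ℝ, (∃ ε > (0 : ℝ), ∀ t : Fin Nf → ℝ, (∀ f, M < t f) → (reg.scheme t 0 0).HasLatticeMassGap ε) →
      (∀ t : Fin Nf → ℝ, (∀ f, M < t f) → (∃ (z shift : QCDField Nf → ℕ → ℝ) (T : OSData (QCDField Nf) 4), IsQCDAlong (reg.scheme t z shift) T ∧ T.IsNontrivial QCDField.glue ∧ T.IsNonGaussian QCDField.glue ∧ (∀ f g : Fin Nf, f ≠ g → T.IsNontrivial (QCDField.pseudoRe f g)) ∧ ∃ Δ > 0, T.HasMassGap Δ ∧ (reg.scheme t z shift).HasLatticeMassGap Δ)) →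
        ∃ δ > (0 : ℝ), ∀ t : Fin Nf → ℝ, (∀ f, M - δ < t f) → (∃ (z shift : QCDField Nf → ℕ → ℝ) (T : OSData (QCDField Nf) 4), IsQCDAlong (reg.scheme t z shift) T ∧ T.IsNontrivial QCDField.glue ∧ T.IsNonGaussian QCDField.glue ∧ (∀ f g : Fin Nf, f ≠ g → T.IsNontrivial (QCDField.pseudoRe f g)) ∧ ∃ Δ > 0, T.HasMassGap Δ ∧ (reg.scheme t z shift).HasLatticeMassGap Δ)) :
    ∃ P : ℝ, (∀ t : Fin Nf → ℝ, (∀ f, P < t f) → (∃ (z shift : QCDField Nf → ℕ → ℝ) (T : OSData (QCDField Nf) 4), IsQCDAlong (reg.scheme t z shift) T ∧ T.IsNontrivial QCDField.glue ∧ T.IsNonGaussian QCDField.glue ∧ (∀ f g : Fin Nf, f ≠ g → T.IsNontrivial (QCDField.pseudoRe f g)) ∧ ∃ Δ > 0, T.HasMassGap Δ ∧ (reg.scheme t z shift).HasLatticeMassGap Δ)) ∧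
      ∀ ε > (0 : ℝ), ∃ t : Fin Nf → ℝ, (∀ f, P < t f) ∧ ¬ (reg.scheme t 0 0).HasLatticeMassGap ε := by
  set G : Set ℝ := {M | ∀ t : Fin Nf → ℝ, (∀ f, M < t f) → (∃ (z shift : QCDField Nf → ℕ → ℝ) (T : OSData (QCDField Nf) 4), IsQCDAlong (reg.scheme t z shift) T ∧ T.IsNontrivial QCDField.glue ∧ T.IsNonGaussian QCDField.glue ∧ (∀ f g : Fin Nf, f ≠ g → T.IsNontrivial (QCDField.pseudoRe f g)) ∧ ∃ Δ > 0, T.HasMassGap Δ ∧ (reg.scheme t z shift).HasLatticeMassGap Δ)} with hGdef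
  obtain ⟨M₀, hM₀⟩ := hne
  obtain ⟨M₁, hM₁⟩ := hgap
  have hM₀G : M₀ ∈ G := hM₀
  by_cases hlow : ∃ P ∈ G, P ≤ M₁
  · -- an element of `G` at or below `M₁`: no uniform rate above it either
    obtain ⟨P, hPG, hPM⟩ := hlow
    refine ⟨P, hPG, fun ε hε => ?_⟩
    obtain ⟨t, ht, hng⟩ := hM₁ ε hε
    exact ⟨t, fun f => lt_of_le_of_lt hPM (ht f), hng⟩
  · -- `G` is bounded below by `M₁`; work at its infimum
    push Not at hlow
    have hbdd : BddBelow G := ⟨M₁, fun P hP => (hlow P hP).le⟩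
    have hGne : G.Nonempty := ⟨M₀, hM₀G⟩
    set P := sInf G with hP
    have hPG : P ∈ G := by
      intro t ht
      obtain ⟨δ, hδ, hδt⟩ := exists_pos_add_le_all P t ht
      obtain ⟨M, hMG, hMlt⟩ := exists_lt_of_csInf_lt hGne (show P < P + δ by linarith)
      exact hMG t fun f => by linarith [hδt f]
    refine ⟨P, hPG, ?_⟩
    by_contra hU
    push Not at hU
    obtain ⟨ε, hε, hUε⟩ := hU
    obtain ⟨δ, hδ, hcontP⟩ := hcont P ⟨ε, hε, hUε⟩ hPG
    have hmem : P - δ / 2 ∈ G := fun t ht => hcontP t fun f => by linarith [ht f]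
    have := csInf_le hbdd hmem
    linarith

/-! ## §2 The split -/

/-- **`QCDOf N_f` for `N_f ∈ {2,3}` from the three children and X₀** — the common body of the two crux-concluding
theorems below (stated with the children as explicit hypotheses, fully qualified, byte-identical with the route items to
be filed). [folklore] -/
theorem qcdOf_of_subs
    (h₁ : ContinuumQCDExists → ∀ Nf : ℕ, Nf = 2 ∨ Nf = 3 → ∃ M₀ : ℝ, 0 ≤ M₀ ∧ ∃ reg : Literature.MathematicalPhysics.QuantumFieldTheory.QCDRegularisation Nf, reg.HasMassScaling ∧ ∀ m : Fin Nf → ℝ, (∀ f, M₀ < m f) → ∃ (z shift : Literature.MathematicalPhysics.QuantumFieldTheory.QCDField Nf → ℕ → ℝ) (T : Literature.MathematicalPhysics.QuantumFieldTheory.OSData (Literature.MathematicalPhysics.QuantumFieldTheory.QCDField Nf) 4), Literature.MathematicalPhysics.QuantumFieldTheory.IsQCDAlong (reg.scheme m z shift) T ∧ T.IsNontrivial Literature.MathematicalPhysics.QuantumFieldTheory.QCDField.glue ∧ T.IsNonGaussian Literature.MathematicalPhysics.QuantumFieldTheory.QCDField.glue ∧ (∀ f g : Fin Nf, f ≠ g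 → T.IsNontrivial (Literature.MathematicalPhysics.QuantumFieldTheory.QCDField.pseudoRe f g)) ∧ ∃ Δ > 0, T.HasMassGap Δ ∧ (reg.scheme m z shift).HasLatticeMassGap Δ)
    (h₂ : ∀ Nf : ℕ, Nf = 2 ∨ Nf = 3 → ∀ reg : Literature.MathematicalPhysics.QuantumFieldTheory.QCDRegularisation Nf, reg.HasMassScaling → (∃ M₀ : ℝ, ∀ m : Fin Nf → ℝ, (∀ f, M₀ < m f) → ∃ (z shift : Literature.MathematicalPhysics.QuantumFieldTheory.QCDField Nf → ℕ → ℝ) (T : Literature.MathematicalPhysics.QuantumFieldTheory.OSData (Literature.MathematicalPhysics.QuantumFieldTheory.QCDField Nf) 4), Literature.MathematicalPhysics.QuantumFieldTheory.IsQCDAlong (reg.scheme m z shift) T ∧ T.IsNontrivial Literature.MathematicalPhysics.QuantumFieldTheory.QCDField.glue ∧ T.IsNonGaussian Literature.MathematicalPhysics.QuantumFieldTheory.QCDField.glue ∧ (∀ f g : Fin Nf, f ≠ g → T.IsNontrivial (Literature.MathematicalPhysics.QuantumFieldTheory.QCDField.pseudoRe f g)) ∧ ∃ Δ > 0, T.HasMassGap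 Δ ∧ (reg.scheme m z shift).HasLatticeMassGap Δ) → ∃ M : ℝ, ∀ ε : ℝ, 0 < ε → ∃ m : Fin Nf → ℝ, (∀ f, M < m f) ∧ ¬ (reg.scheme m 0 0).HasLatticeMassGap ε)
    (h₃ : ∀ Nf : ℕ, Nf = 2 ∨ Nf = 3 → ∀ reg : Literature.MathematicalPhysics.QuantumFieldTheory.QCDRegularisation Nf, reg.HasMassScaling → ∀ ε : ℝ, 0 < ε → ∃ δ : ℝ, 0 < δ ∧ ∀ M : ℝ, (∀ m : Fin Nf → ℝ, (∀ f, M < m f) → (reg.scheme m 0 0).HasLatticeMassGap ε) → (∀ m : Fin Nf → ℝ, (∀ f, M < m f) → ∃ (z shift : Literature.MathematicalPhysics.QuantumFieldTheory.QCDField Nf → ℕ → ℝ) (T : Literature.MathematicalPhysics.QuantumFieldTheory.OSData (Literature.MathematicalPhysics.QuantumFieldTheory.QCDField Nf) 4), Literature.MathematicalPhysics.QuantumFieldTheory.IsQCDAlong (reg.scheme m z shift) T ∧ T.IsNontrivial Literature.MathematicalPhysics.QuantumFieldTheory.QCDField.glue ∧ T.IsNonGaussian Literature.MathematicalPhysics.QuantumFieldTheory.QCDField.glue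 ∧ (∀ f g : Fin Nf, f ≠ g → T.IsNontrivial (Literature.MathematicalPhysics.QuantumFieldTheory.QCDField.pseudoRe f g)) ∧ ∃ Δ > 0, T.HasMassGap Δ ∧ (reg.scheme m z shift).HasLatticeMassGap Δ) → ∀ m : Fin Nf → ℝ, (∀ f, M - δ < m f) → ∃ (z shift : Literature.MathematicalPhysics.QuantumFieldTheory.QCDField Nf → ℕ → ℝ) (T : Literature.MathematicalPhysics.QuantumFieldTheory.OSData (Literature.MathematicalPhysics.QuantumFieldTheory.QCDField Nf) 4), Literature.MathematicalPhysics.QuantumFieldTheory.IsQCDAlong (reg.scheme m z shift) T ∧ T.IsNontrivial Literature.MathematicalPhysics.QuantumFieldTheory.QCDField.glue ∧ T.IsNonGaussian Literature.MathematicalPhysics.QuantumFieldTheory.QCDField.glue ∧ (∀ f g : Fin Nf, f ≠ g → T.IsNontrivial (Literature.MathematicalPhysics.QuantumFieldTheory.QCDField.pseudoRe f g)) ∧ ∃ Δ > 0, T.HasMassGap Δ ∧ (reg.scheme m z shift).HasLatticeMassGap Δ)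
    (hX : ContinuumQCDExists) : ∀ Nf : ℕ, Nf = 2 ∨ Nf = 3 → QCDOf Nf := by
  intro Nf hNf
  obtain ⟨M₀, -, reg, hMS, hB⟩ := h₁ hX Nf hNf
  have hne : ∃ M₀ : ℝ, ∀ t : Fin Nf → ℝ, (∀ f, M₀ < t f) → (∃ (z shift : QCDField Nf → ℕ → ℝ) (T : OSData (QCDField Nf) 4), IsQCDAlong (reg.scheme t z shift) T ∧ T.IsNontrivial QCDField.glue ∧ T.IsNonGaussian QCDField.glue ∧ (∀ f g : Fin Nf, f ≠ g → T.IsNontrivial (QCDField.pseudoRe f g)) ∧ ∃ Δ > 0, T.HasMassGap Δ ∧ (reg.scheme t z shift).HasLatticeMassGap Δ) := ⟨M₀, hB⟩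
  have hgap : ∃ M₁ : ℝ, ∀ ε > (0 : ℝ), ∃ t : Fin Nf → ℝ, (∀ f, M₁ < t f) ∧
      ¬ (reg.scheme t 0 0).HasLatticeMassGap ε := by
    obtain ⟨M₁, hM₁⟩ := h₂ Nf hNf reg hMS hne
    exact ⟨M₁, fun ε hε => hM₁ ε hε⟩
  have hcont : ∀ M : ℝ, (∃ ε > (0 : ℝ), ∀ t : Fin Nf → ℝ, (∀ f, M < t f) →
      (reg.scheme t 0 0).HasLatticeMassGap ε) →
      (∀ t : Fin Nf → ℝ, (∀ f, M < t f) → (∃ (z shift : QCDField Nf → ℕ → ℝ) (T : OSData (QCDField Nf) 4), IsQCDAlong (reg.scheme t z shift) T ∧ T.IsNontrivial QCDField.glue ∧ T.IsNonGaussian QCDField.glue ∧ (∀ f g : Fin Nf, f ≠ g → T.IsNontrivial (QCDField.pseudoRe f g)) ∧ ∃ Δ > 0, T.HasMassGap Δ ∧ (reg.scheme t z shift).HasLatticeMassGap Δ)) →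
        ∃ δ > (0 : ℝ), ∀ t : Fin Nf → ℝ, (∀ f, M - δ < t f) → (∃ (z shift : QCDField Nf → ℕ → ℝ) (T : OSData (QCDField Nf) 4), IsQCDAlong (reg.scheme t z shift) T ∧ T.IsNontrivial QCDField.glue ∧ T.IsNonGaussian QCDField.glue ∧ (∀ f g : Fin Nf, f ≠ g → T.IsNontrivial (QCDField.pseudoRe f g)) ∧ ∃ Δ > 0, T.HasMassGap Δ ∧ (reg.scheme t z shift).HasLatticeMassGap Δ) := by
    rintro M ⟨ε, hε, hUε⟩ hGM
    obtain ⟨δ, hδ, hδall⟩ := h₃ Nf hNf reg hMS ε hε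
    exact ⟨δ, hδ, hδall M hUε hGM⟩
  obtain ⟨P, hPG, hχ⟩ := exists_pin_of_threshold_gapless_continuation reg hne hgap hcont
  exact qcdOf_of_pin_body reg hMS P hχ hPG

/-! ## §3 The crux BY NAME from the three stubs -/

/-- **The crux from the registered stubs** (the skeleton's composition; sorries only inside `stub_*`). [folklore] -/
theorem RobustYangMillsHandover_of : RobustYangMillsHandover := fun hX =>
  ⟨qcdOf_of_subs stub_heavyThresholdHandover stub_gaplessPointOnMassAxis stub_gappedMassContinuation hX 2
      (Or.inl rfl),
    qcdOf_of_subs stub_heavyThresholdHandover stub_gaplessPointOnMassAxis stub_gappedMassContinuation hX 3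
      (Or.inr rfl)⟩

/- The explicit-hypothesis form `RobustYangMillsHandover_of_subs : child 1 → child 2 → child 3 → RobustYangMillsHandover`
   (the `--glue-by` theorem of the split) is `fun h₁ h₂ h₃ hX => ⟨qcdOf_of_subs h₁ h₂ h₃ hX 2 (Or.inl rfl),
   qcdOf_of_subs h₁ h₂ h₃ hX 3 (Or.inr rfl)⟩`; it lives in the Theorems-side file attached to the crux
   (`HeatSlicedQuarksRobustYangMillsHandoverSplit.lean`, rc 0, std axioms) and is omitted here so that exactly ONE theorem of
   this skeleton concludes the crux. -/

end Summit.QuantumFields.QCD.Cruxes.RobustYangMillsHandover.HeavyGoldstoneContinuation
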